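import Summits.BirchSwinnertonDyer.BirchSwinnertonDyer.Theses.BiquadraticEisensteinDescent
import Literature.NumberTheory.EllipticCurves.HeegnerPoints
import Literature.NumberTheory.EllipticCurves.ComplexMultiplicationTwistIsogenyProofs
import HarnessLib

set_option linter.dupNamespace false
set_option autoImplicit false

/-!
# Sketch (crux-ideate seat 1, g3, round 1) — first lemmas of the crux idea
# `linear-sturm-legendre-residue` for `HeegnerTwistCouplingInSupply` (stmt-BirchSwinnertonDyer-21381)

Nothing is asserted or proved: one `def … : Prop` per statement of the line. Constants used
(`lean search`): `Rank1Residual.CMInert/Good/cmFieldDiscrOfJ`, `IsImaginaryQuadratic`,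
`SatisfiesHeegnerHypothesis`, `cm7`, `WeierstrassCurve.quadraticTwist/entireLFunction/analyticRank/
HasCM/conductorNorm`, Mathlib `jacobiSym`, `NumberField.discr/classNumber`.

The line (CM discriminant `−7`, i.e. `W` a quadratic twist of `A = cm7 = 49a1`, typed first; the
other class-number-one discriminants `−11, −19, −43, −67, −163` are the same with `λ = |d_K|`,
`k = (λ+1)/4`):
* `RubinSwitchSevenJacobi`      — card B's K1 in elementary form: `7 ∤ Σ_{a<D} (a/D) a²`
                                  (`= D·B_{2,χ_D}`) ⟹ `L(A^{(D)}, 1) ≠ 0` (Rubin 1983 Thm 1 / Kummer).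
* `IsCouplingFieldAwayFromP`    — the crux's conclusion for one field minus the behaviour of `p`
                                  (but `p` unramified): NOT cheaper than the crux — every condition
                                  at `p` (coprimality included) costs level `p²` (kit j296002).
* `RamifiedSelfWitnessSeven`    — the SATURATION fact: `K' = ℚ(√−p)` itself does everything except
                                  split at `p` (`W^{(−p)} ≅ W₀`, `h(−p) < p`), whenever `L(W₀,1) ≠ 0`
                                  and the `N₀`-primes split in `ℚ(√−p)`; provable outright.
* `RamifiedSupplyBulkSeven`     — route-owner variant: with `p` RAMIFIED in `K'` the supply holds
                                  for `p ≥ p₀(N₀)` from prescribed-local-behaviour non-vanishing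
                                  (Friedberg–Hoffstein 1995 Thm B) alone. Not the crux (which needs
                                  `p` split); recorded because it bounds what any level-linear
                                  argument can see.
* `LegendreSignSplitSturmSeven` — the RESIDUAL `(R*)`: a `7`-good `n = |d'|` with the Legendre
                                  condition `(−n/p) = +1`, in the range `n ≤ C·N₀^C·p²/log³p`
                                  (the common `p²` threshold of Sturm / first moment / Kohnen–Ono,
                                  minus a polylog, inside a quadratic-residue class at `p`) — stated
                                  purely on generalized Bernoulli sums.
* `SignSplitClosesSeven`        — `(R*)` + K1 ⟹ the crux in the bulk of the `−7` sub-corner.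
-/

noncomputable section

open scoped NumberField Classical
open WeierstrassCurve NumberField
open Literature.NumberTheory.EllipticCurves
open Literature.NumberTheory.EllipticCurves.Rank1Residual

namespace Summit.BirchSwinnertonDyer.BirchSwinnertonDyer.Cruxes.HeegnerTwistCouplingInSupply.G3

/-- The corner of the crux: `W` CM, analytic rank one, `p ≥ 5` inert in the CM field and bad. -/
def InCorner (W : WeierstrassCurve ℚ) [W.IsElliptic] [W.IsGloballyMinimal] (p : ℕ) [Fact p.Prime] :
    Prop :=
  W.HasCM ∧ W.analyticRank = 1 ∧ 5 ≤ p ∧ CMInert W p ∧ ¬ Good W p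

/-- The conclusion of the crux for ONE field `K` (verbatim conjuncts of `HeegnerTwistCouplingInSupply`). -/
def IsCouplingField (W : WeierstrassCurve ℚ) (p : ℕ) (K : Type) [Field K] [NumberField K] : Prop :=
  IsImaginaryQuadratic K ∧ 4 < (NumberField.discr K).natAbs ∧
    SatisfiesHeegnerHypothesis (W.conductorNorm ℤ) K ∧
    (W.quadraticTwist (NumberField.discr K : ℚ)).entireLFunction 1 ≠ 0 ∧
    ¬ p ∣ NumberField.classNumber K

/-- The same conclusion MINUS the behaviour of `p` in `K`: Heegner hypothesis only for the
prime-to-`p` conductor `N₀ = N_W / p²` (in the corner `N_W = p² N₀`, `p ∤ N₀`) and `p` UNRAMIFIED in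
`K` (split or inert). Without the unramified clause the predicate has TRIVIAL witnesses
`K = ℚ(√−p m)` (`W^{(−pm)} ≅ W₀^{(m)}` is `p`-free, `h(−pm) < p` for `m ≪ p/log² p`): every piece
of information of level linear in `p` is saturated by them (`RamifiedSelfWitnessSeven`,
`RamifiedSupplyBulkSeven`). Even WITH the unramified clause it is not cheaper than the crux:
coprimality to `p` is itself a condition of level `p²` (kit j296002). A field with this property
and `p` inert closes only the generalised-Heegner (Yuan–Zhang–Zhang) variant of the supply. -/
def IsCouplingFieldAwayFromP (W : WeierstrassCurve ℚ) (p : ℕ) (K : Type) [Field K] [NumberField K] :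
    Prop :=
  IsImaginaryQuadratic K ∧ 4 < (NumberField.discr K).natAbs ∧
    SatisfiesHeegnerHypothesis (W.conductorNorm ℤ / p ^ 2) K ∧ ¬ (p : ℤ) ∣ NumberField.discr K ∧
    (W.quadraticTwist (NumberField.discr K : ℚ)).entireLFunction 1 ≠ 0 ∧
    ¬ p ∣ NumberField.classNumber K

/-- `D · B_{2,χ_D} = Σ_{0 ≤ a < D} χ_D(a) a²` for the quadratic character of conductor `D`, written
with the Jacobi symbol `(a/D)` — valid as the Kronecker character `χ_D` when `D ≡ 1 (mod 4)` is a
positive fundamental discriminant (quadratic reciprocity). An integer; `7 ∤ jacobiBernoulliTwoSum D`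
iff `7 ∤ B_{2,χ_D}/2` when `7 ∤ D`. -/
def jacobiBernoulliTwoSum (D : ℕ) : ℤ :=
  ∑ a ∈ Finset.range D, jacobiSym (a : ℤ) D * (a : ℤ) ^ 2

/-- **K1 (card B's Rubin–Bernoulli switch at `λ = 7`, elementary form).** For a positive
fundamental discriminant `D ≡ 1 (mod 4)` prime to `7`: if `7 ∤ Σ_{a<D} (a/D)a²` then
`L(A^{(D)}, 1) ≠ 0` for `A = cm7 = 49a1`. Source: Rubin, Invent. Math. 71 (1983) Thm 1
(`L(ψ̄χ,1)/Ω ≡ unit · B_{1,χω}² (mod 𝔮)`) and Kummer `B_{1,χω} ≡ B_{2,χ}/2 (mod 𝔮)`,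
`ω ≡ ·^{(7−3)/4+…}`; validated numerically on 270/270 twists (kit j290176, g0). The unit `u_A`
in Rubin's congruence is the K1 risk. -/
def RubinSwitchSevenJacobi : Prop :=
  ∀ D : ℕ, 4 < D → D % 4 = 1 → Squarefree D → ¬ 7 ∣ D →
    ¬ (7 : ℤ) ∣ jacobiBernoulliTwoSum D →
      (cm7.quadraticTwist (D : ℚ)).entireLFunction 1 ≠ 0

/-- SATURATION BY THE RAMIFIED FIELD `ℚ(√−p)` (the reason "coupling away from `p`" is not a crux).
In the `−7` sub-corner with `p ≡ 3 (mod 4)` write `W ≅ W₀^{(−p)}`, `W₀ = cm7^{(D₀)}` of conductor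
`N₀ = N_W/p²`. Then `W^{(−p)} ≅ W₀`, `ε(W₀) = −ε(W) = +1`, `h(−p) ≤ (√p/π)(ln p + 3) < p` (`p ≥ 5`), and
`|d_{ℚ(√−p)}| = p > 4`; so IF `L(W₀, 1) ≠ 0` and every prime of `7·D₀` splits in `ℚ(√−p)`, the field
`ℚ(√−p)` satisfies every conjunct of the crux except the splitting of `p` (it ramifies). Provable
from twist composition + the class number formula bound; no modularity input beyond `L(W₀,1)`. -/
def RamifiedSelfWitnessSeven : Prop :=
  ∀ (W : WeierstrassCurve ℚ) [W.IsElliptic] [W.IsGloballyMinimal] (p : ℕ) [Fact p.Prime]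
    [NeZero (W.conductorNorm ℤ)],
    InCorner W p → cmFieldDiscrOfJ W.j = -7 → p % 4 = 3 →
    ∀ (D₀ : ℕ), D₀ % 4 = 1 → Squarefree D₀ → Nat.Coprime D₀ (7 * p) →
      (∃ c : VariableChange ℚ, c • cm7.quadraticTwist (-(D₀ : ℚ) * p) = W) →
      (cm7.quadraticTwist (D₀ : ℚ)).entireLFunction 1 ≠ 0 →
      (∀ q : ℕ, q.Prime → q ∣ 7 * D₀ → jacobiSym (-(p : ℤ)) q = 1) →
      ∃ (K : Type) (_ : Field K) (_ : NumberField K),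
        IsImaginaryQuadratic K ∧ NumberField.discr K = -(p : ℤ) ∧ 4 < (NumberField.discr K).natAbs ∧
          SatisfiesHeegnerHypothesis (W.conductorNorm ℤ / p ^ 2) K ∧
          (W.quadraticTwist (NumberField.discr K : ℚ)).entireLFunction 1 ≠ 0 ∧
          ¬ p ∣ NumberField.classNumber K

/-- ROUTE-OWNER VARIANT (not the crux): the supply with `p` RAMIFIED in `K'` instead of split, in
the bulk `p ≥ p₀(N₀)`. For each sign pattern `η` on the primes of `7 D₀` pick the least positive
fundamental `m'` coprime to `p` with `(m'/q) = η_q` and `L(W₀^{(m')}, 1) ≠ 0` (exists by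
Friedberg–Hoffstein 1995 Thm B, sign `ε(W₀^{(m')}) = ε(W₀) = +1` since `N₀` is a square); then
`K' = ℚ(√(−p m'))` has `W^{(−pm')} ≅ W₀^{(m')}`, Heegner at `N₀`, and `h(−pm') < p` once
`p ≫ m' log² m'`. Any argument whose information is of level LINEAR in `p` proves at most this. -/
def RamifiedSupplyBulkSeven : Prop :=
  ∃ p₀ : ℕ → ℕ,
    ∀ (W : WeierstrassCurve ℚ) [W.IsElliptic] [W.IsGloballyMinimal] (p : ℕ) [Fact p.Prime]
      [NeZero (W.conductorNorm ℤ)],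
      InCorner W p → cmFieldDiscrOfJ W.j = -7 → p₀ (W.conductorNorm ℤ / p ^ 2) ≤ p →
      ∃ (K : Type) (_ : Field K) (_ : NumberField K),
        IsImaginaryQuadratic K ∧ 4 < (NumberField.discr K).natAbs ∧ (p : ℤ) ∣ NumberField.discr K ∧
          SatisfiesHeegnerHypothesis (W.conductorNorm ℤ / p ^ 2) K ∧
          (W.quadraticTwist (NumberField.discr K : ℚ)).entireLFunction 1 ≠ 0 ∧
          ¬ p ∣ NumberField.classNumber K

/-- **K4 = the residual `(R*)`: Legendre-class Sturm with polylog gain, on the Bernoulli side.**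
Parameters: `A^{(D₀)}` is the twist-core `W₀` (`D₀ ≡ 1 (mod 4)` squarefree, prime to `7p`; the odd
sub-family suffices for an existence statement), `p ≡ 3 (mod 4)` with `(−7/p) = −1` (the corner
primes of `W = A^{(D₀ · p*)}`, `p* = −p`, analytic rank one forces `D₀ · p* < 0`, i.e. `D₀ > 0`).
Claim: for `p ≥ p₀(D₀)` there is a squarefree `n ≡ 3 (mod 4)`, `4 < n ≤ C·D₀^C·p²/(log₂ p)³`,
with `d' = −n` Heegner for `49·D₀²` AND `(−n/p) = +1` (so `p` splits in `ℚ(√−n)`, and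
`h(−n) < p` automatically), such that `7 ∤ Σ_{a<D} (a/D)a²` for `D = D₀·p·n`
(`= D₀·p*·d' > 0`, `≡ 1 (mod 4)`), i.e. `7 ∤ B_{2,χ_D}/2`, i.e. (by K1) `L(W^{(d')}, 1) ≠ 0`.
Plain Sturm on the `χ_p`-symmetrised form gives only `n ≤ C'·p²·(…)` (level `p²`), where `h < p`
is no longer free: the polylog is the entire open content. No class number appears. -/
def LegendreSignSplitSturmSeven : Prop :=
  ∃ (C : ℕ) (p₀ : ℕ → ℕ),
    ∀ (D₀ p : ℕ), p.Prime → p % 4 = 3 → jacobiSym (-7) p = -1 →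
      D₀ % 4 = 1 → Squarefree D₀ → Nat.Coprime D₀ (7 * p) → p₀ D₀ ≤ p →
      ∃ n : ℕ, 4 < n ∧ n % 4 = 3 ∧ Squarefree n ∧
        n * (Nat.log 2 p) ^ 3 ≤ C * D₀ ^ C * p ^ 2 ∧
        (∀ q : ℕ, q.Prime → q ∣ 7 * D₀ → jacobiSym (-(n : ℤ)) q = 1) ∧
        jacobiSym (-(n : ℤ)) p = 1 ∧
        ¬ (7 : ℤ) ∣ jacobiBernoulliTwoSum (D₀ * p * n)

/-- **Assembly shape of the line (informal target of the card, typed):** `(R*)` and the switch K1,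
together with the identification `W^{(d')} ≅ A^{(D₀ p* d')}` for `W ≅ A^{(D₀ p*)}` in the corner,
give a coupling field for every corner pair of CM discriminant `−7` with `p ≡ 3 (mod 4)`,
`p ≥ p₀(N₀)`; the finitely many `p < p₀(N₀)` per `N₀` are NOT covered (the TAIL, see the card). -/
def SignSplitClosesSeven : Prop :=
  LegendreSignSplitSturmSeven → RubinSwitchSevenJacobi →
    ∃ p₀ : ℕ → ℕ,
      ∀ (W : WeierstrassCurve ℚ) [W.IsElliptic] [W.IsGloballyMinimal] (p : ℕ) [Fact p.Prime]
        [NeZero (W.conductorNorm ℤ)],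
        InCorner W p → cmFieldDiscrOfJ W.j = -7 → p % 4 = 3 →
        (∃ (D₀ : ℕ) (c : VariableChange ℚ), D₀ % 4 = 1 ∧ Squarefree D₀ ∧
            c • cm7.quadraticTwist (-(D₀ : ℚ) * p) = W) →
        p₀ (W.conductorNorm ℤ / p ^ 2) ≤ p →
        ∃ (K : Type) (_ : Field K) (_ : NumberField K), IsCouplingField W p K

end Summit.BirchSwinnertonDyer.BirchSwinnertonDyer.Cruxes.HeegnerTwistCouplingInSupply.G3
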